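import Literature.NumberTheory.EllipticCurves.TwoAdicImageNonSurjectiveFamiliesProofs
import Literature.NumberTheory.EllipticCurves.QuadraticTwist
import Literature.NumberTheory.EllipticCurves.Greenberg1999.TwoTorsionMuInvariant
import HarnessLib

/-!
# Surjectivity of `ρ̄_{E,2}`, `ρ̄_{E,4}`, `ρ̄_{E,8}` and of the `2`-adic image is a QUADRATIC-TWIST
# INVARIANT over `ℚ` (iff form), and so is each off-habitat stratum (proofs only)

Topic `NumberTheory/EllipticCurves`; theorem-only `Proofs`-style file (no definition, no named fact,
no instance, no `sorry`; D-0014/D-0026), continuing `TwoAdicImageNonSurjectiveFamiliesProofs`.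

Dokchitser–Dokchitser's criteria (Math. Z. 272 (2012), Theorem (1)–(3), PROVED in the tree) decide the
levels `2`, `4`, `8` — and by the mod-`8` lift the whole `2`-adic image — of `E/ℚ` by data that are
INVARIANT under quadratic twist `E ↦ E^{(d)}` (`d ∈ ℚ^×`, the model `WeierstrassCurve.quadraticTwist`:
`a₁ = a₃ = 0`, `a₂ = d b₂/4`, `a₄ = d² b₄/2`, `a₆ = d³ b₆/4`): a rational point of order `2` (abscissa
`x ↦ d·x`: `hasRationalTwoTorsionX_quadraticTwist_iff`), `Δ ↦ d⁶Δ` (so `Δ`, `-Δ`, `±2Δ` modulo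
squares are unchanged), `j ↦ j`.  Hence, as EQUIVALENCES (`d ≠ 0`):

* `hasSurjectiveModNGaloisRep_two_quadraticTwist_iff`, `…_four_…`, `…_eight_…`,
  `forall_hasSurjectiveModNGaloisRep_two_pow_quadraticTwist_iff` — `ρ̄_{E^{(d)},2^m}` onto ⟺
  `ρ̄_{E,2^m}` onto for `2^m ∈ {2, 4, 8}` and for all `m` at once (the summit-side
  `TwoAdicGoodTwists.hasSurjectiveModNGaloisRep_quadraticTwist`, Rouse–Zureick-Brown Rem. 1.6, gives
  "⟹" at every level by the signed twist isomorphism; the "⟸" halves here need no Galois theory);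
* the five off-habitat families (β) `E(ℚ)[2] ≠ 0`, (γ₁) `Δ ∈ ℚ^{×2}`, (γ₂) `-Δ ∈ ℚ^{×2}`,
  (γ₃) `j = -4t³(t + 8)`, (γ₄) `±2Δ ∈ ℚ^{×2}` are each twist-closed — so every typed piece of the
  off-habitat complement of the BSD cell's rank-`0` `2`-converse (route `TwoAdicConverse`, item 19218)
  is a statement about quadratic-twist CLASSES, like the habitat itself.

Also: the bridge `exists_two_torsion_iff_exists_hasRationalTwoTorsionX'` between Dokchitser–Dokchitser's
"`E(K)` has a point of exact order `2`" and Greenberg's abscissa predicate `HasRationalTwoTorsionX`.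
Nothing about BSD is claimed.

## References

* [DokchitserDokchitserMathZ2012] T. Dokchitser, V. Dokchitser, *Surjectivity of mod `2ⁿ`
  representations of elliptic curves*, Math. Z. 272 (2012) 961–964, Theorem (1)–(3).
* [RouseZureickbrown2015] J. Rouse, D. Zureick-Brown, *Elliptic curves over `ℚ` and `2`-adic images
  of Galois*, Res. Number Theory 1 (2015), Remark 1.6 (twisting moves the image inside `±H`).
* [SilvermanAEC2009] J. H. Silverman, *The Arithmetic of Elliptic Curves*, 2nd ed., GTM 106 (2009),
  X.2 Prop. 2.4, X.5 Cor. 5.4 (quadratic twists), III.2.3 (points of order `2`).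
* [GreenbergLNM1716] R. Greenberg, LNM 1716 (1999), Prop. 5.14 (the abscissa of a rational `2`-torsion point).
-/

set_option autoImplicit false

open WeierstrassCurve

namespace Literature.NumberTheory.EllipticCurves

open Greenberg1999

/-! ### §1. Squares and the twist of `Δ` -/

/-- `c² a` is a square iff `a` is (`c ≠ 0`, any field). [folklore] -/
private theorem isSquare_sq_mul_iff {K : Type*} [Field K] {c : K} (hc : c ≠ 0) (a : K) :
    IsSquare (c ^ 2 * a) ↔ IsSquare a := by
  constructor
  · rintro ⟨s, hs⟩
    exact ⟨s / c, by field_simp; linear_combination hs⟩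
  · rintro ⟨r, hr⟩
    exact ⟨c * r, by rw [hr]; ring⟩

section Twist

variable (W : WeierstrassCurve ℚ) {d : ℚ} (hd : d ≠ 0)

include hd

/-- **`Δ(E^{(d)}) = d⁶Δ(E)` is a square iff `Δ(E)` is.** [cite: SilvermanAEC2009, X.5 Cor. 5.4 and III.1] -/
theorem isSquare_Δ_quadraticTwist_iff : IsSquare (W.quadraticTwist d).Δ ↔ IsSquare W.Δ := by
  rw [quadraticTwist_Δ, show d ^ 6 * W.Δ = (d ^ 3) ^ 2 * W.Δ by ring]
  exact isSquare_sq_mul_iff (pow_ne_zero 3 hd) _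

/-- **`-Δ(E^{(d)})` is a square iff `-Δ(E)` is.** [cite: SilvermanAEC2009, X.5 Cor. 5.4 and III.1] -/
theorem isSquare_neg_Δ_quadraticTwist_iff : IsSquare (-(W.quadraticTwist d).Δ) ↔ IsSquare (-W.Δ) := by
  rw [quadraticTwist_Δ, show -(d ^ 6 * W.Δ) = (d ^ 3) ^ 2 * (-W.Δ) by ring]
  exact isSquare_sq_mul_iff (pow_ne_zero 3 hd) _

/-- **`2Δ(E^{(d)})` is a square iff `2Δ(E)` is.** [cite: SilvermanAEC2009, X.5 Cor. 5.4 and III.1] -/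
theorem isSquare_two_mul_Δ_quadraticTwist_iff :
    IsSquare (2 * (W.quadraticTwist d).Δ) ↔ IsSquare (2 * W.Δ) := by
  rw [quadraticTwist_Δ, show 2 * (d ^ 6 * W.Δ) = (d ^ 3) ^ 2 * (2 * W.Δ) by ring]
  exact isSquare_sq_mul_iff (pow_ne_zero 3 hd) _

/-- **`-2Δ(E^{(d)})` is a square iff `-2Δ(E)` is.** [cite: SilvermanAEC2009, X.5 Cor. 5.4 and III.1] -/
theorem isSquare_neg_two_mul_Δ_quadraticTwist_iff :
    IsSquare (-2 * (W.quadraticTwist d).Δ) ↔ IsSquare (-2 * W.Δ) := by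
  rw [quadraticTwist_Δ, show -2 * (d ^ 6 * W.Δ) = (d ^ 3) ^ 2 * (-2 * W.Δ) by ring]
  exact isSquare_sq_mul_iff (pow_ne_zero 3 hd) _

/-- **The Dokchitser–Dokchitser family `j = -4t³(t + 8)` is twist-closed** (`j(E^{(d)}) = j(E)`).
[cite: DokchitserDokchitserMathZ2012, Lemma (3)] [cite: SilvermanAEC2009, X.5 Cor. 5.4] -/
theorem exists_j_eq_quadraticTwist_iff [W.IsElliptic] :
    (haveI := W.isElliptic_quadraticTwist hd
     ∃ t : ℚ, (W.quadraticTwist d).j = -4 * t ^ 3 * (t + 8)) ↔ ∃ t : ℚ, W.j = -4 * t ^ 3 * (t + 8) := by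
  haveI := W.isElliptic_quadraticTwist hd
  rw [W.j_quadraticTwist hd]

end Twist

/-! ### §2. Rational `2`-torsion under twist -/

/-- **Dokchitser–Dokchitser's "a point of exact order `2`" versus Greenberg's abscissa predicate**
(any model over `ℚ`): `E(ℚ)` has a point `P ≠ 0` with `2P = 0` iff some `x` has
`HasRationalTwoTorsionX W x` (a rational affine point `(x, y)` with `2y + a₁x + a₃ = 0`).  Twin of the
summit-side `TwoAdicOffHabitat.exists_two_torsion_iff_exists_hasRationalTwoTorsionX`, restated here so
that Literature files can use it. [cite: GreenbergLNM1716, Prop. 5.14] [cite: SilvermanAEC2009, Prop. III.2.3] -/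
theorem exists_two_torsion_iff_exists_hasRationalTwoTorsionX' (W : WeierstrassCurve ℚ) [W.IsElliptic] :
    (∃ P : W.toAffine.Point, P ≠ 0 ∧ 2 • P = 0) ↔ ∃ x : ℚ, HasRationalTwoTorsionX W x := by
  constructor
  · rintro ⟨P, hP0, h2P⟩
    rcases P with _ | ⟨x, y, hns⟩
    · exact absurd rfl hP0
    · refine ⟨x, y, hns.left, ?_⟩
      by_contra hy'
      have hy : y ≠ W.toAffine.negY x y := by
        intro h
        apply hy'
        rw [WeierstrassCurve.Affine.negY] at h
        linear_combination h
      rw [two_nsmul, WeierstrassCurve.Affine.Point.add_self_of_Y_ne hy] at h2P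
      exact WeierstrassCurve.Affine.Point.some_ne_zero _ h2P
  · rintro ⟨x, y, hEq, h2⟩
    refine ⟨.some _ _ ((WeierstrassCurve.Affine.equation_iff_nonsingular).mp hEq),
      WeierstrassCurve.Affine.Point.some_ne_zero _, ?_⟩
    rw [two_nsmul, WeierstrassCurve.Affine.Point.add_self_of_Y_eq]
    rw [WeierstrassCurve.Affine.negY]
    linear_combination h2

/-- `HasRationalTwoTorsionX W x` iff `x` is a rational root of the `2`-division cubic
`4x³ + b₂x² + 2b₄x + b₆` (the ordinate is then forced: `y = -(a₁x + a₃)/2`).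
[cite: SilvermanAEC2009, Prop. III.2.3 (points of order 2)] -/
theorem hasRationalTwoTorsionX_iff_twoDivision (W : WeierstrassCurve ℚ) (x : ℚ) :
    HasRationalTwoTorsionX W x ↔ 4 * x ^ 3 + W.b₂ * x ^ 2 + 2 * W.b₄ * x + W.b₆ = 0 := by
  constructor
  · rintro ⟨y, hEq, h2⟩
    exact fourXCubed_add_eq_zero_of_twoTorsion hEq h2
  · intro h
    refine ⟨-(W.a₁ * x + W.a₃) / 2, (equation_line_iff_twoDivision W two_ne_zero x).mpr h, ?_⟩
    ring

/-- **A rational `2`-torsion abscissa twists to one**: `x` is the abscissa of a rational point of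
order `2` on `E` iff `d·x` is one on `E^{(d)}` (`d ≠ 0`; the `2`-division cubic of the model
`quadraticTwist` at `d·x` is `d³` times that of `E` at `x`). [cite: SilvermanAEC2009, X.5 Cor. 5.4 and Prop. III.2.3] -/
theorem hasRationalTwoTorsionX_quadraticTwist_iff (W : WeierstrassCurve ℚ) {d : ℚ} (hd : d ≠ 0) (x : ℚ) :
    HasRationalTwoTorsionX (W.quadraticTwist d) (d * x) ↔ HasRationalTwoTorsionX W x := by
  rw [hasRationalTwoTorsionX_iff_twoDivision, hasRationalTwoTorsionX_iff_twoDivision]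
  have key : 4 * (d * x) ^ 3 + (W.quadraticTwist d).b₂ * (d * x) ^ 2 +
      2 * (W.quadraticTwist d).b₄ * (d * x) + (W.quadraticTwist d).b₆ =
        d ^ 3 * (4 * x ^ 3 + W.b₂ * x ^ 2 + 2 * W.b₄ * x + W.b₆) := by
    simp only [WeierstrassCurve.b₂, WeierstrassCurve.b₄, WeierstrassCurve.b₆, quadraticTwist_a₁,
      quadraticTwist_a₂, quadraticTwist_a₃, quadraticTwist_a₄, quadraticTwist_a₆]
    ring
  rw [key, mul_eq_zero, or_iff_right (pow_ne_zero 3 hd)]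

/-- **Family (β) is twist-closed** (abscissa form): `E^{(d)}(ℚ)` has a `2`-torsion abscissa iff `E(ℚ)`
has. [cite: SilvermanAEC2009, X.5 Cor. 5.4 and Prop. III.2.3] -/
theorem exists_hasRationalTwoTorsionX_quadraticTwist_iff (W : WeierstrassCurve ℚ) {d : ℚ} (hd : d ≠ 0) :
    (∃ x : ℚ, HasRationalTwoTorsionX (W.quadraticTwist d) x) ↔ ∃ x : ℚ, HasRationalTwoTorsionX W x := by
  constructor
  · rintro ⟨x, hx⟩
    refine ⟨x / d, (hasRationalTwoTorsionX_quadraticTwist_iff W hd (x / d)).mp ?_⟩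
    rwa [mul_div_cancel₀ x hd]
  · rintro ⟨x, hx⟩
    exact ⟨d * x, (hasRationalTwoTorsionX_quadraticTwist_iff W hd x).mpr hx⟩

/-- **Family (β) is twist-closed** (point form): `E^{(d)}(ℚ)` has a point of exact order `2` iff
`E(ℚ)` has (`d ≠ 0`). [cite: SilvermanAEC2009, X.5 Cor. 5.4 and Prop. III.2.3] -/
theorem exists_two_torsion_quadraticTwist_iff (W : WeierstrassCurve ℚ) [W.IsElliptic] {d : ℚ} (hd : d ≠ 0) :
    (haveI := W.isElliptic_quadraticTwist hd
     ∃ P : (W.quadraticTwist d).toAffine.Point, P ≠ 0 ∧ 2 • P = 0) ↔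
      ∃ P : W.toAffine.Point, P ≠ 0 ∧ 2 • P = 0 := by
  haveI := W.isElliptic_quadraticTwist hd
  rw [exists_two_torsion_iff_exists_hasRationalTwoTorsionX',
    exists_two_torsion_iff_exists_hasRationalTwoTorsionX', exists_hasRationalTwoTorsionX_quadraticTwist_iff W hd]

/-- **"No rational point of order `2`" is twist-invariant** (the first conjunct of
Dokchitser–Dokchitser (1)). [cite: DokchitserDokchitserMathZ2012, Theorem (1)] -/
theorem forall_two_nsmul_quadraticTwist_iff (W : WeierstrassCurve ℚ) [W.IsElliptic] {d : ℚ} (hd : d ≠ 0) :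
    (haveI := W.isElliptic_quadraticTwist hd
     ∀ P : (W.quadraticTwist d).toAffine.Point, 2 • P = 0 → P = 0) ↔
      ∀ P : W.toAffine.Point, 2 • P = 0 → P = 0 := by
  haveI := W.isElliptic_quadraticTwist hd
  have h := exists_two_torsion_quadraticTwist_iff W hd
  constructor
  · intro hall P h2P
    by_contra hP0
    obtain ⟨Q, hQ0, h2Q⟩ := h.mpr ⟨P, hP0, h2P⟩
    exact hQ0 (hall Q h2Q)
  · intro hall P h2P
    by_contra hP0
    obtain ⟨Q, hQ0, h2Q⟩ := h.mp ⟨P, hP0, h2P⟩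
    exact hQ0 (hall Q h2Q)

/-! ### §3. The levels `2`, `4`, `8` and the `2`-adic image under twist (iff) -/

section Levels

variable (W : WeierstrassCurve ℚ) [W.IsElliptic] {d : ℚ} (hd : d ≠ 0)

include hd

/-- **`ρ̄_{E^{(d)},2}` onto ⟺ `ρ̄_{E,2}` onto** (Dokchitser–Dokchitser (1): no rational `2`-torsion and
`Δ ∉ ℚ^{×2}`, both twist-invariant). [cite: DokchitserDokchitserMathZ2012, Theorem (1)] [cite: RouseZureickbrown2015, Remark 1.6] -/
theorem hasSurjectiveModNGaloisRep_two_quadraticTwist_iff :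
    (W.quadraticTwist d).HasSurjectiveModNGaloisRep 2 ↔ W.HasSurjectiveModNGaloisRep 2 := by
  haveI := W.isElliptic_quadraticTwist hd
  rw [hasSurjectiveModNGaloisRep_two_iff, hasSurjectiveModNGaloisRep_two_iff,
    forall_two_nsmul_quadraticTwist_iff W hd, isSquare_Δ_quadraticTwist_iff W hd]

/-- **`ρ̄_{E^{(d)},4}` onto ⟺ `ρ̄_{E,4}` onto** (Dokchitser–Dokchitser (2): level `2`, `-Δ ∉ ℚ^{×2}`,
`j ≠ -4t³(t + 8)`, all twist-invariant). [cite: DokchitserDokchitserMathZ2012, Theorem (2)] [cite: RouseZureickbrown2015, Remark 1.6] -/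
theorem hasSurjectiveModNGaloisRep_four_quadraticTwist_iff :
    (W.quadraticTwist d).HasSurjectiveModNGaloisRep 4 ↔ W.HasSurjectiveModNGaloisRep 4 := by
  haveI := W.isElliptic_quadraticTwist hd
  rw [DokchitserDokchitser2012.hasSurjectiveModNGaloisRep_four_iff,
    DokchitserDokchitser2012.hasSurjectiveModNGaloisRep_four_iff,
    hasSurjectiveModNGaloisRep_two_quadraticTwist_iff W hd, isSquare_neg_Δ_quadraticTwist_iff W hd,
    W.j_quadraticTwist hd]

/-- **`ρ̄_{E^{(d)},8}` onto ⟺ `ρ̄_{E,8}` onto** (Dokchitser–Dokchitser (3): level `4` and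
`±2Δ ∉ ℚ^{×2}`). [cite: DokchitserDokchitserMathZ2012, Theorem (3)] [cite: RouseZureickbrown2015, Remark 1.6] -/
theorem hasSurjectiveModNGaloisRep_eight_quadraticTwist_iff :
    (W.quadraticTwist d).HasSurjectiveModNGaloisRep 8 ↔ W.HasSurjectiveModNGaloisRep 8 := by
  haveI := W.isElliptic_quadraticTwist hd
  rw [DokchitserDokchitser2012.hasSurjectiveModNGaloisRep_eight_iff,
    DokchitserDokchitser2012.hasSurjectiveModNGaloisRep_eight_iff,
    hasSurjectiveModNGaloisRep_four_quadraticTwist_iff W hd, isSquare_two_mul_Δ_quadraticTwist_iff W hd,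
    isSquare_neg_two_mul_Δ_quadraticTwist_iff W hd]

/-- **The surjective-`2`-adic-image habitat is a union of quadratic-twist classes** (iff form):
`ρ̄_{E^{(d)},2^m}` onto for all `m` ⟺ `ρ̄_{E,2^m}` onto for all `m`.
[cite: DokchitserDokchitserMathZ2012, Theorem (1)–(3)] [cite: RouseZureickbrown2015, Remark 1.6 and §1] -/
theorem forall_hasSurjectiveModNGaloisRep_two_pow_quadraticTwist_iff :
    (∀ m : ℕ, (W.quadraticTwist d).HasSurjectiveModNGaloisRep ((2 ^ m : ℕ) : ℤ)) ↔
      ∀ m : ℕ, W.HasSurjectiveModNGaloisRep ((2 ^ m : ℕ) : ℤ) := by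
  haveI := W.isElliptic_quadraticTwist hd
  rw [forall_hasSurjectiveModNGaloisRep_two_pow_iff_eight, forall_hasSurjectiveModNGaloisRep_two_pow_iff_eight,
    hasSurjectiveModNGaloisRep_eight_quadraticTwist_iff W hd]

/-- **The off-habitat complement is a union of quadratic-twist classes.**
[cite: DokchitserDokchitserMathZ2012, Theorem (1)–(3)] [cite: RouseZureickbrown2015, Remark 1.6] -/
theorem not_forall_hasSurjectiveModNGaloisRep_two_pow_quadraticTwist_iff :
    (¬ ∀ m : ℕ, (W.quadraticTwist d).HasSurjectiveModNGaloisRep ((2 ^ m : ℕ) : ℤ)) ↔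
      ¬ ∀ m : ℕ, W.HasSurjectiveModNGaloisRep ((2 ^ m : ℕ) : ℤ) := by
  rw [forall_hasSurjectiveModNGaloisRep_two_pow_quadraticTwist_iff W hd]

/-- **Stratum (S2c)/(γ₁) is twist-closed**: "no rational `2`-torsion and `Δ ∈ ℚ^{×2}`" (the `C₃`
image modulo `2`) holds for `E^{(d)}` iff for `E`. [cite: DokchitserDokchitserMathZ2012, Theorem (1)] -/
theorem c3Stratum_quadraticTwist_iff :
    (haveI := W.isElliptic_quadraticTwist hd
     (∀ P : (W.quadraticTwist d).toAffine.Point, 2 • P = 0 → P = 0) ∧ IsSquare (W.quadraticTwist d).Δ) ↔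
      (∀ P : W.toAffine.Point, 2 • P = 0 → P = 0) ∧ IsSquare W.Δ := by
  rw [forall_two_nsmul_quadraticTwist_iff W hd, isSquare_Δ_quadraticTwist_iff W hd]

/-- **Stratum (γ₂) is twist-closed**: "`ρ̄₂` onto and `-Δ ∈ ℚ^{×2}`" (`ℚ(√Δ) = ℚ(i)`) holds for
`E^{(d)}` iff for `E`. [cite: DokchitserDokchitserMathZ2012, Theorem (1), (2)] -/
theorem qiStratum_quadraticTwist_iff :
    ((W.quadraticTwist d).HasSurjectiveModNGaloisRep 2 ∧ IsSquare (-(W.quadraticTwist d).Δ)) ↔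
      (W.HasSurjectiveModNGaloisRep 2 ∧ IsSquare (-W.Δ)) := by
  rw [hasSurjectiveModNGaloisRep_two_quadraticTwist_iff W hd, isSquare_neg_Δ_quadraticTwist_iff W hd]

/-- **Stratum (S4) is twist-closed**: "`ρ̄₂` onto, `ρ̄₄` not onto". [cite: DokchitserDokchitserMathZ2012, Theorem (1), (2)] -/
theorem levelFourStratum_quadraticTwist_iff :
    ((W.quadraticTwist d).HasSurjectiveModNGaloisRep 2 ∧ ¬ (W.quadraticTwist d).HasSurjectiveModNGaloisRep 4) ↔
      (W.HasSurjectiveModNGaloisRep 2 ∧ ¬ W.HasSurjectiveModNGaloisRep 4) := by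
  rw [hasSurjectiveModNGaloisRep_two_quadraticTwist_iff W hd,
    hasSurjectiveModNGaloisRep_four_quadraticTwist_iff W hd]

/-- **Stratum (S8) is twist-closed**: "`ρ̄₄` onto, `ρ̄₈` not onto". [cite: DokchitserDokchitserMathZ2012, Theorem (2), (3)] -/
theorem levelEightStratum_quadraticTwist_iff :
    ((W.quadraticTwist d).HasSurjectiveModNGaloisRep 4 ∧ ¬ (W.quadraticTwist d).HasSurjectiveModNGaloisRep 8) ↔
      (W.HasSurjectiveModNGaloisRep 4 ∧ ¬ W.HasSurjectiveModNGaloisRep 8) := by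
  rw [hasSurjectiveModNGaloisRep_four_quadraticTwist_iff W hd,
    hasSurjectiveModNGaloisRep_eight_quadraticTwist_iff W hd]

end Levels

end Literature.NumberTheory.EllipticCurves
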